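import Summits.QuantumFields.BalabanUV.Beta.FP.HessKerReflectionSplit
import Summits.QuantumFields.BalabanUV.Beta.FP.PerfectPropagatorReflection
import Summits.QuantumFields.BalabanUV.Beta.D1BFx.GhostStencil
import Summits.QuantumFields.BalabanUV.Beta.D1BFx.FiniteStencilCalculus

/-!
# `BalabanUV.Beta.FP.GhostJetReflection` — road «FP» for binder row D1, sub-row **H2-ASM-5a** (Kcov), module R3 layer b: THE GHOST SECTOR OF `PiBF` AT THE TYPED EXPLICIT
# GHOST DATA IS REFLECTION COVARIANT WITH NO LETTER LEFT — the ghost current `D1BFx.GhostStencil.ghCur` obeys the bond-reflection law against the scalar leg relabellings of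
# `PerfectPropagatorReflection` (under which `G0ker` is invariant), the tadpole of the typed contact family `Wgh` over `G0ker` is the explicit bond-diagonal kernel
# `[μ = ν][z = 0]·cW·latticeGreen 0∕2`, hence `AxisReflectionCovariant (fun μ ν z => hessKer G0ker (cV • ghCur) (Wgh cW) μ ν (−z))` UNCONDITIONALLY

HONEST DEPENDENCY (page 1, mandatory): continuum YM on T⁴ ⇐ BetaPertH ∧ nine spine estimates (0/9 proved); BetaPertH ⇐ (D1) ∧ (D4) ∧ CAP+tail;
G-an2-4 gates asym, D1 and NE2/3/4.  HONEST FRAMING (cell contract, verbatim): «discharging `BetaPertH` makes Bałaban's UV stability UNCONDITIONAL —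
a real constructive-QFT result; it is NOT the continuum limit and NOT the Clay problem.»  THIS MODULE DISCHARGES NOTHING of the wall: indicator algebra on the typer's explicit
ghost stencils (`D1BFx.GhostStencil.ghCur`∕`ghCnt`∕`Wgh`, [our object] defs of the tree) + d1-p2's finite-stencil tadpole formula (`D1BFx.FiniteStencilCalculus.tadpole_elemK`) + R3 layer a
(`HessKerReflectionSplit`) + R2 layer b (`PerfectPropagatorReflection.exists_legMap_refK_G0ker`) BY NAME; 0 def, 0 `def … : Prop`, nothing cited, 0 sorry; 0∕4 row-D1 binders.
SCOPE (verbatim from `GhostStencil`): the `Q′(U)` second jets are NOT typed in `Wgh` (v1); the road's ghost data of H2V-0∕H2V-3 are the B-jets of `Δ_B = d_B^* d_B` (no averaging), read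
here as `(cV • ghCur, Wgh cW)` with the weights `cV`, `cW` FREE (an3's dictionary ∕ H2-ASM-4 fix them — not asserted).  NOT the gluon sector (its first-order letters and tadpole word stay
displayed), NOT hasym, NOT D1, NOT BetaPertH, NOT continuum, NOT Clay.

ABSOLUTE RULE (cell charter, verbatim): «No internally-minted statement may enter as a cited fact. Every hypothesis is either kernel-proved in this package or a
verbatim quotation of a PUBLISHED theorem with page reference. The manuscript(s) under audit are NOT citable for their own disputed steps — they are the thing
under adjudication; programme-internal (2001/route/tribunal) claims are never citable.»

CONTENT: §2 **`ghCur_bondRefl`**: `ghCur μ (bondRefl α (−c) μ y) = reflSign α μ • refK Ψ (ghCur μ y)` for every scalar relabelling `Ψ` by `y ↦ εy + c•e_α`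
(the first-order (a7) letter of R2a∕R3a's ghost sector, PROVED); §3 `Wgh_of_pos`∕`Wgh_of_neg`, `ghCnt_eq_elemK`, **`tadpole_Wgh`** (any leg), **`tadpole_G0ker_Wgh`**
(`= [μ = ν ∧ y = y′]·cW·latticeGreen 0∕2`); LOCATED REMARK (asserted nowhere as a defect): `Wgh` itself does NOT obey R2a's termwise second-order law at `κ′ = α` (the contact sits
at the upper endpoint `u + e_κ′`; the reflected bond's contact sits at the lower one) — which is why R3a's tadpole-word form is the one to use; §4 **`axisReflectionCovariant_flip_tadpoleKer_ghost`** (any scalar leg; R3a's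
`axisReflectionCovariant_flip_tadpoleKer_of_bondDiagonal`); §5 **`axisReflectionCovariant_flip_hessKer_ghost`** (UNCONDITIONAL) and **`axisReflectionCovariant_flipK_PiBF_ghostTyped`**:
`AxisReflectionCovariant (flipK (PiBF wg wgh V W (fun μ y => cV • ghCur μ y) (Wgh cW)))` from the GLUON-sector letters alone (first-order laws against a `Pker`-invariant `Φα` + the
gluon tadpole word).
Provenance: D1 formalisation swarm seat b2b-balaban-beta-d1-formalise-leaf-02 gen 9 (road FP engine lineage; sub-row H2-ASM-5a (Kcov) REFLECTION HALF), 2026-08-21.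
-/

noncomputable section

namespace Summit.QuantumFields.BalabanUV.Beta.FP.GhostJetReflection

open Finset
open scoped BigOperators
open Literature.MathematicalPhysics.QuantumFieldTheory.Balaban1983to89
open Literature.MathematicalPhysics.QuantumFieldTheory.Balaban1983to89.Beta
open B6BondElimination (unitVec unitVec_apply)
open PolarizationSign (axisReflect axisReflect_apply reflSign AxisReflectionCovariant)
open ExpKernelCalculus (MKer Site BiLoc comp tr bubble tadpole hessKer shiftK)
open OneStepResolventKernel (Fib)
open OneStepKernelFamily (flipK flipK_apply)
open KernelWard (Bdd)
open KernelReflection (LegMap refK refK_apply bondRefl tadpole_smul)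
open Literature.Probability.LatticeModels (latticeGreen)
open Summit.QuantumFields.BalabanUV.Beta.D1BFx.GhostStencil (ghCur ghCur_apply ghCur_translate biLoc_ghCur ghCnt ghCnt_apply Wgh)
open Summit.QuantumFields.BalabanUV.Beta.D1BFx.FiniteStencilCalculus (elemK elemK_apply tadpole_elemK)
open Summit.QuantumFields.BalabanUV.Beta.FP.PerfectPolarization (Pker G0ker PiBF PiBF_def Pker_translate G0ker_translate G0ker_apply)
open Summit.QuantumFields.BalabanUV.Beta.FP.PerfectPolarizationWard (bdd_Pker bdd_G0ker)
open Summit.QuantumFields.BalabanUV.Beta.FP.PerfectPolarizationReflection (axisReflectionCovariant_lincomb)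
open Summit.QuantumFields.BalabanUV.Beta.FP.PerfectPropagatorReflection (axisReflect_add_smul_involutive exists_legMap_refK_G0ker)
open StepDriftWitness (tadpole_zero)
open Summit.QuantumFields.BalabanUV.Beta.FP.HessKerReflectionSplit (axisReflectionCovariant_flip_hessKer_one_of_tadpoleKer axisReflectionCovariant_flip_tadpoleKer_of_bondDiagonal)

/-! ## §2 The ghost current obeys the bond-reflection law -/

/-- [our object] **THE FIRST-ORDER GHOST LETTER, PROVED**: for every scalar leg relabelling `Ψ` moving sites by `y ↦ εy + c•e_α` (the maps of
`PerfectPropagatorReflection.exists_legMap_refK_G0ker`, under which `G0ker` is invariant), the ghost current at the reflected, re-based bond is the signed relabelled current: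
`ghCur μ (bondRefl α (−c) μ y) = ε_μ • refK Ψ (ghCur μ y)` (an `α`-bond is reversed — sign `ε_α = −1` — and re-based at its other endpoint). -/
theorem ghCur_bondRefl (α μ : Fin 4) (c : ℤ) (Ψ : LegMap 4 Unit) (hr : ∀ y : Site 4, Ψ.r () y = axisReflect α y + c • unitVec α) (y : Site 4) :
    ghCur μ (bondRefl α (-c) μ y) = reflSign α μ • refK Ψ (ghCur μ y) := by
  have hU : (AffineAveraging.unitVec μ : Site 4) = unitVec μ := by
    funext i; simp [AffineAveraging.unitVec_apply, unitVec_apply]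
  have hinv : ∀ x w : Site 4, (Ψ.r () x = w) ↔ (x = axisReflect α w + c • unitVec α) := by
    intro x w
    rw [hr]
    constructor
    · intro h; rw [← h]; exact (axisReflect_add_smul_involutive α c x).symm
    · intro h; rw [h]; exact axisReflect_add_smul_involutive α c w
  have hunit : ∀ (K : MKer 4 Unit) (x z : Site 4), refK Ψ K x z () () = K (Ψ.r () x) (Ψ.r () z) () () := fun K x z => by
    rw [refK_apply, Ψ.s_mul_s, one_mul]
  funext x z a b
  rcases a with ⟨⟩; rcases b with ⟨⟩
  simp only [Pi.smul_apply, smul_eq_mul, hunit, ghCur_apply, hU, hinv]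
  by_cases hμ : μ = α
  · subst hμ
    have e1 : axisReflect μ (y + unitVec μ) + c • unitVec μ = bondRefl μ (-c) μ y := by
      funext i
      simp only [bondRefl, Pi.add_apply, Pi.sub_apply, Pi.smul_apply, axisReflect_apply, smul_eq_mul, unitVec_apply, if_true]
      by_cases hi : i = μ
      · simp [hi]; ring
      · simp [hi]
    have e2 : axisReflect μ y + c • unitVec μ = bondRefl μ (-c) μ y + unitVec μ := by
      funext i
      simp only [bondRefl, Pi.add_apply, Pi.sub_apply, Pi.smul_apply, axisReflect_apply, smul_eq_mul, unitVec_apply, if_true]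
      by_cases hi : i = μ
      · simp [hi]; ring
      · simp [hi]
    rw [e1, e2]
    simp only [PolarizationSign.reflSign, if_true]
    ring
  · have e1 : axisReflect α (y + unitVec μ) + c • unitVec α = bondRefl α (-c) μ y + unitVec μ := by
      funext i
      simp only [bondRefl, Pi.add_apply, Pi.sub_apply, Pi.smul_apply, axisReflect_apply, smul_eq_mul, unitVec_apply, hμ, if_false]
      by_cases hi : i = α
      · subst hi; simp [Ne.symm hμ]
      · simp [hi]
    have e2 : axisReflect α y + c • unitVec α = bondRefl α (-c) μ y := by
      funext i
      simp only [bondRefl, Pi.add_apply, Pi.sub_apply, Pi.smul_apply, axisReflect_apply, smul_eq_mul, unitVec_apply, hμ, if_false]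
      by_cases hi : i = α
      · subst hi; simp
      · simp [hi]
    rw [e1, e2]
    simp only [PolarizationSign.reflSign, hμ, if_false, one_mul]

/-! ## §3 The tadpole of the typed contact family is an explicit bond-diagonal kernel -/

/-- [our object] the diagonal entries of the contact family. -/
theorem Wgh_of_pos {cW : ℝ} {μ ν : Fin 4} {y y' : Site 4} (h : μ = ν ∧ y = y') : Wgh cW μ y ν y' = cW • ghCnt μ y := by
  funext x z a b
  show (if μ = ν ∧ y = y' then cW * ghCnt μ y x z a b else 0) = cW * ghCnt μ y x z a b
  rw [if_pos h]

/-- [our object] the off-diagonal entries of the contact family vanish. -/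
theorem Wgh_of_neg {cW : ℝ} {μ ν : Fin 4} {y y' : Site 4} (h : ¬(μ = ν ∧ y = y')) : Wgh cW μ y ν y' = 0 := by
  funext x z a b
  show (if μ = ν ∧ y = y' then cW * ghCnt μ y x z a b else 0) = 0
  rw [if_neg h]

/-- [our object] the same-bond contact is the elementary insertion of `1` at the located pair `(u + e_κ′, u + e_κ′)` (d1-p2's `FiniteStencilCalculus.elemK`). -/
theorem ghCnt_eq_elemK (μ : Fin 4) (y : Site 4) :
    ghCnt μ y = elemK (y + AffineAveraging.unitVec μ) (y + AffineAveraging.unitVec μ) (fun _ _ => (1 : ℝ)) := by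
  funext x z a b
  rw [ghCnt_apply, elemK_apply]

/-- [our object] **THE TADPOLE OF THE CONTACT FAMILY OVER ANY SCALAR LEG**: `tadpole A (Wgh cW μ y ν y′) = [μ = ν ∧ y = y′]·cW·A (y + e_μ) (y + e_μ)`. -/
theorem tadpole_Wgh (A : MKer 4 Unit) (cW : ℝ) (μ ν : Fin 4) (y y' : Site 4) :
    tadpole A (Wgh cW μ y ν y')
      = if μ = ν ∧ y = y' then cW * A (y + AffineAveraging.unitVec μ) (y + AffineAveraging.unitVec μ) () () else 0 := by
  by_cases h : μ = ν ∧ y = y'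
  · rw [if_pos h, Wgh_of_pos h, tadpole_smul, ghCnt_eq_elemK, tadpole_elemK]
    simp only [Fintype.sum_unique, mul_one]
  · rw [if_neg h, Wgh_of_neg h]
    exact tadpole_zero A

/-- [our object] **OVER THE GHOST LEG**: `tadpole G0ker (Wgh cW μ y ν y′) = [μ = ν ∧ y = y′]·cW·latticeGreen 0∕2` — a constant on the bond diagonal.  LOCATED REMARK (asserted
nowhere as a defect): the table `Wgh` itself does NOT obey the termwise second-order reflection law of R2a at `κ′ = α` (its contact sits at the upper endpoint of the bond, the
reflected bond's at the lower); its tadpole does not see the difference. -/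
theorem tadpole_G0ker_Wgh (cW : ℝ) (μ ν : Fin 4) (y y' : Site 4) :
    tadpole G0ker (Wgh cW μ y ν y') = if μ = ν ∧ y = y' then cW * (latticeGreen (0 : Site 4) / 2) else 0 := by
  rw [tadpole_Wgh]
  by_cases h : μ = ν ∧ y = y'
  · rw [if_pos h, if_pos h, G0ker_apply, sub_self]
  · rw [if_neg h, if_neg h]

/-! ## §4 The tadpole word of the ghost sector is reflection covariant -/

/-- [our object] **THE GHOST TADPOLE WORD IS REFLECTION COVARIANT** over ANY scalar leg: `AxisReflectionCovariant (fun μ ν z => tadpole A (Wgh cW μ 0 ν (−z)))` — the word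
is that of a bond-diagonal table (`Wgh_of_neg`), so R3a's `axisReflectionCovariant_flip_tadpoleKer_of_bondDiagonal` applies. -/
theorem axisReflectionCovariant_flip_tadpoleKer_ghost (A : MKer 4 Unit) (cW : ℝ) : AxisReflectionCovariant (fun μ ν z => tadpole A (Wgh cW μ 0 ν (-z))) :=
  axisReflectionCovariant_flip_tadpoleKer_of_bondDiagonal A fun _ _ _ _ h => Wgh_of_neg h

/-! ## §5 The ghost sector of `PiBF` at the typed data: reflection covariant, no letter left -/

/-- [our object] **THE GHOST-SECTOR RESOLVENT HESSIAN KERNEL AT THE TYPED EXPLICIT DATA IS REFLECTION COVARIANT, UNCONDITIONALLY**: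
`AxisReflectionCovariant (fun μ ν z => hessKer G0ker (fun μ y => cV • ghCur μ y) (Wgh cW) μ ν (−z))` for all real weights `cV`, `cW` (leg `G0ker` bounded and translation invariant —
gan24-leaf-02's `bdd_G0ker`, `G0ker_translate`; current bi-localised and translation covariant — the typer's `biLoc_ghCur`, `ghCur_translate`; first-order law §2 against the
`G0ker`-invariant relabelling of R2 layer b; tadpole word §4; assembled by R3 layer a). -/
theorem axisReflectionCovariant_flip_hessKer_ghost (cV cW : ℝ) :
    AxisReflectionCovariant (fun μ ν z => hessKer G0ker (fun μ y => cV • ghCur μ y) (Wgh cW) μ ν (-z)) := by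
  have hV : ∀ (μ : Fin 4) (y : Site 4), BiLoc ((fun μ y => cV • ghCur μ y) μ y) y y (|cV| * Real.exp 1) 1 := by
    intro μ y x z a b
    show |cV * ghCur μ y x z a b| ≤ |cV| * Real.exp 1 * Real.exp (-1 * (B12Sec2to5.l1 (x - y) + B12Sec2to5.l1 (z - y)))
    rw [abs_mul, mul_assoc]
    exact mul_le_mul_of_nonneg_left (biLoc_ghCur μ y 1 x z a b) (abs_nonneg cV)
  have hcov : ∀ (μ : Fin 4) (y t : Site 4), (fun μ y => cV • ghCur μ y) μ (y + t) = shiftK (-t) ((fun μ y => cV • ghCur μ y) μ y) := by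
    intro μ y t
    show cV • ghCur μ (y + t) = shiftK (-t) (cV • ghCur μ y)
    rw [ghCur_translate]
    rfl
  have hrefl : ∀ α : Fin 4, ∃ Ψα : LegMap 4 Unit, refK Ψα G0ker = G0ker ∧ ∃ c : ℤ,
      ∀ μ y, (fun μ y => cV • ghCur μ y) μ (bondRefl α c μ y) = reflSign α μ • refK Ψα ((fun μ y => cV • ghCur μ y) μ y) := by
    intro α
    obtain ⟨Ψ, hG, hr, -⟩ := exists_legMap_refK_G0ker α 0
    refine ⟨Ψ, hG, 0, fun μ y => ?_⟩
    show cV • ghCur μ (bondRefl α 0 μ y) = reflSign α μ • refK Ψ (cV • ghCur μ y)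
    have h := ghCur_bondRefl α μ 0 Ψ hr y
    rw [neg_zero] at h
    have hsm : refK Ψ (cV • ghCur μ y) = cV • refK Ψ (ghCur μ y) := by
      funext x' z' a b
      simp only [refK_apply, Pi.smul_apply, smul_eq_mul]
      ring
    rw [h, hsm, smul_comm]
  exact axisReflectionCovariant_flip_hessKer_one_of_tadpoleKer bdd_G0ker G0ker_translate hV hcov one_pos hrefl
    (axisReflectionCovariant_flip_tadpoleKer_ghost G0ker cW)

/-- [our object] **(Kcov) FOR `PiBF` WITH THE GHOST SECTOR AT THE TYPED DATA — GLUON LETTERS ONLY**: for gluon data `(V, W)` bi-localised at the unit-lattice bonds and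
translation covariant, with the first-order bond-reflection law against a `Pker`-invariant relabelling (every axis) and the gluon tadpole word reflection covariant,
`AxisReflectionCovariant (flipK (PiBF wg wgh V W (fun μ y => cV • ghCur μ y) (Wgh cW)))` for every `wg wgh cV cW`. -/
theorem axisReflectionCovariant_flipK_PiBF_ghostTyped (wg wgh cV cW : ℝ)
    {V : Fin 4 → Site 4 → MKer 4 (Fib 3)} {W : Fin 4 → Site 4 → Fin 4 → Site 4 → MKer 4 (Fib 3)} {Cv δ : ℝ} (hδ : 0 < δ)
    (hV : ∀ (μ : Fin 4) (y : Site 4), BiLoc (V μ y) y y Cv δ) (hcovV : ∀ (μ : Fin 4) (y t : Site 4), V μ (y + t) = shiftK (-t) (V μ y))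
    (hreflV : ∀ α : Fin 4, ∃ Φα : LegMap 4 (Fib 3), refK Φα Pker = Pker ∧ ∃ c : ℤ, ∀ μ y, V μ (bondRefl α c μ y) = reflSign α μ • refK Φα (V μ y))
    (htadP : AxisReflectionCovariant (fun μ ν z => tadpole Pker (W μ 0 ν (-z)))) :
    AxisReflectionCovariant (flipK (PiBF wg wgh V W (fun μ y => cV • ghCur μ y) (Wgh cW))) := by
  have h1 := axisReflectionCovariant_flip_hessKer_one_of_tadpoleKer bdd_Pker Pker_translate hV hcovV hδ hreflV htadP
  have h2 := axisReflectionCovariant_flip_hessKer_ghost cV cW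
  have h := axisReflectionCovariant_lincomb h1 h2 wg wgh
  intro α μ ν z
  have h' := h α μ ν z
  simp only [flipK_apply, PiBF_def] at h' ⊢
  exact h'

end Summit.QuantumFields.BalabanUV.Beta.FP.GhostJetReflection

end
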